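import Summits.QuantumFields.YangMills.Theorems.UnitScaleTiltProp7CommutatorChain
import Summits.QuantumFields.YangMills.Theorems.UnitScaleTiltProp7CoCurlOfCurvatureCommutator
import Literature.MathematicalPhysics.QuantumFieldTheory.Balaban1983to89.B10Eq27TorusAxialLog
import Literature.MathematicalPhysics.QuantumFieldTheory.Balaban1983to89.B16Txt357ThirdOrderNonAbelian
import HarnessLib

/-!
# Route `UnitScaleTilt`, crux K1 «MinimiserStabilityRegPr» (stmt-QuantumFields-19200), route-R E′ path (α′), S3 K-form engine, row (R4′) — FILE 9e (core, torus letters):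
# THE AXIAL (COMB) LOCAL MODEL `Ψ(x) = R(v₀(x)⁻¹)m`, `v₀(x) = W(Γ_{c,x})` — its covariant derivative is the conjugate of `R(loop)m − m` and its covariant Laplacian the conjugate of
# `Σ_μ(2m − R(loop at x−e_μ)⁻¹m − R(loop at x)m)` EXACTLY; hence the commutator-currency rows `‖D_WΨ(x,μ)‖ ≤ N_m(h(x,μ))` and
# `‖Δ_WΨ(x)‖ ≤ Σ_μ (N_m(h(x−e_μ,μ)⁻¹·h(x,μ)) + 2‖h(x−e_μ,μ) − 1‖·N_m(h(x−e_μ,μ)))` (double-ladder commutator + second order)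

Cell `ym3-torus`, D-0154 (3c) twin-width seat `ym-routeR-w1` (gen 6); row (R4′) «framed-constant models in commutator currency» (namer ★ym-ust-19200-p1 g15, 2026-08-28 20:45Z; S3-CURVED
verdict 21:04Z «K-form engine GO door-first; R4 = ✓p666125 + (R4′)»; LOCATE v1.1 `ym-routeR-w1/LOCATE-R4PRIME-routeRw1g6.md` = 19200 evidence #52, §2 (D)(D*)(L)).  THEOREMS ONLY
(0 `def`, 0 `sorry`); `--supports stmt-QuantumFields-19200`, count-neutral.  YM₃ on T³ is a ladder rung (R3), not the Clay problem; nothing here claims a stub, the crux, d = 4 or the mass gap.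

WHAT (ns `…Theorems.Prop7AxialLocalModel`; torus `Site P j`, ANY group of units `𝔸ˣ` of a ring ∕ normed ring, `V : GaugeField P j 𝔸ˣ`, base `c`, the comb transport
✓ `B10Eq27TorusAxialLog.axialT V c x = holT V c (treeWord (rel c x))`, the loop ✓ `holT V c (contourT c b)` of (27), local model `Ψ x := R (axialT V c x)⁻¹ m`).
* §1 (any ring) ★★ `covD_axialModel` — under the no-wrap condition of ✓ `holT_contourT` at the bond `⟨x,μ⟩`:
  `D_VΨ(x,μ) = R((axialT V c x)⁻¹)·(R(holT V c (contourT c ⟨x,μ⟩)) m − m)`; `covDstar_eq_neg_R_covD` (`D*_μG(x) = −R(V⟨x−e_μ,μ⟩⁻¹)(D_μG)(x−e_μ)`, any field);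
  ★★ `lap_axialModel` — under no-wrap at `⟨x,μ⟩` and `⟨x−e_μ,μ⟩` for every `μ`:
  `Δ_VΨ(x) = R((axialT V c x)⁻¹)·Σ_μ (2m − R(h(x−e_μ,μ)⁻¹)m − R(h(x,μ))m)`, `h(z,μ) := holT V c (contourT c ⟨z,μ⟩)`; `axialModel_base` (`Ψ(c) = m`).
* §2 (normed ring, `V` bi-contractive; `‖R(u)X‖ ≤ ‖X‖` is ✓ `B16Txt357ThirdOrderNonAbelian.norm_R_le`) ★ `norm_covD_axialModel_le` (`≤ N_m(h(x,μ))`), `norm_covDstar_axialModel_le` (`≤ N_m(h(x−e_μ,μ))`), ★★ `norm_lap_axialModel_le`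
  (`≤ Σ_μ [N_m(h(x−e_μ,μ)⁻¹h(x,μ)) + 2‖h(x−e_μ,μ) − 1‖·N_m(h(x−e_μ,μ))]` — the DOUBLE-LADDER commutator (adjacent parallel ladders: curvature DIFFERENCES ∕ ray-summed current,
  LOCATE §6) plus a second-order term), via ✓ `Prop7CoCurlOfCurvatureCommutator.R_sub_R_eq` and F-H9d `Prop7CommutatorChain.norm_R_sub_self_le_comm_of_inv`.
All commutators VANISH when `m` commutes with the loop holonomies based at `c` (aligned data) — the point of (R4′).
HONEST SCOPE.  Exact torus algebra + triangle inequalities.  NOT here: the ladder∕Stokes reading of `h` as a product of plaquettes (F-H9d's chain rule is the abstract half; the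
straight-ladder recursion and the comb-AVERAGED model with its multiplicity counts are the next file), the junction to `K_gauge(φ₀)`, the (Kg)∕(eM) numbers, any use in ✓p666125.

References: T. Bałaban, CMP 98 (1985) 17–51 [Balaban1985Averaging] ((8)–(9) pp.18–19, p.24); CMP 102 (1985) 255–275 [Balaban1985UV3] ((27) p.263); CMP 99 (1985) 389–434
[Balaban1985BackgroundPropagators] ((3.3)–(3.4) pp.390–391, (3.8) p.392).
-/

set_option autoImplicit false

noncomputable section

open scoped BigOperators

namespace Summit.QuantumFields.YangMills.Theorems.Prop7AxialLocalModel

open Literature.MathematicalPhysics.QuantumFieldTheory.Balaban1983to89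
open B9Eq39Adjoint (R R_def R_sub R_neg R_one R_inv_R R_R_inv covD covDstar divB)
open B9TorusCalculus (torusT torusT_apply torusT_symm_apply)
open B10Eq27TorusAxialLog (holT axialT contourT rel holT_contourT axialT_self)
open Summit.QuantumFields.YangMills.Theorems.Prop7CoCurlOfCurvatureCommutator (R_sub_R_eq)
open Summit.QuantumFields.YangMills.Theorems.Prop7CommutatorChain (norm_R_sub_self_le_comm_of_inv norm_R_inv_sub_self_le_comm_of_inv comm_sub_one)
open Summit.QuantumFields.YangMills.Theorems.Prop7ConjFrameTransport (R_finset_sum)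
open B16Txt357ThirdOrderNonAbelian (norm_R_le)

/-! ## §1 The exact identities -/

section Ring

variable {𝔸 : Type*} [Ring 𝔸] {P : Params} {j : ℕ} (V : GaugeField P j 𝔸ˣ) (c : Site P j) (m : 𝔸)

/-- the axial local model interpolates at its base: `Ψ(c) = m` (`v₀(c) = 1`, ✓ `axialT_self`). [cite: Balaban1985Averaging, p.24] -/
theorem axialModel_base : R (axialT V c c)⁻¹ m = m := by
  rw [axialT_self, inv_one, R_one]

/-- ★★ **THE COVARIANT DERIVATIVE OF THE AXIAL LOCAL MODEL IS A CONJUGATED LOOP DEFECT**: with no wrap-around at `⟨x,μ⟩`,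
`D_VΨ(x,μ) = R(v₀(x)⁻¹)·(R(V(Γ_{c,x} ∪ ⟨x,μ⟩ ∪ Γ_{x+e_μ,c})) m − m)`. [cite: Balaban1985UV3, (27) p.263; Balaban1985BackgroundPropagators, (3.3) p.390] -/
theorem covD_axialModel (μ : Fin P.d) (x : Site P j) (hx : (rel c x μ + 1) * 2 ≤ (P.sitesPerDir j : ℤ)) :
    covD (torusT P j) (fun κ z => V ⟨z, κ⟩) μ (fun z => R (axialT V c z)⁻¹ m) x
      = R (axialT V c x)⁻¹ (R (holT V c (contourT c ⟨x, μ⟩)) m - m) := by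
  have hloop := holT_contourT V c ⟨x, μ⟩ hx
  -- `V⟨x,μ⟩ · v₀(x+e_μ)⁻¹ = v₀(x)⁻¹ · loop`
  have hkey : V ⟨x, μ⟩ * (axialT V c (PBond.tgt ⟨x, μ⟩))⁻¹ = (axialT V c x)⁻¹ * holT V c (contourT c ⟨x, μ⟩) := by
    rw [hloop]; group
  show R (V ⟨x, μ⟩) (R (axialT V c (torusT P j μ x))⁻¹ m) - R (axialT V c x)⁻¹ m = _
  have htgt : torusT P j μ x = PBond.tgt ⟨x, μ⟩ := rfl
  rw [htgt, ← B9Eq39Adjoint.R_mul, hkey, B9Eq39Adjoint.R_mul, ← R_sub]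

/-- `D*_μG(x) = −R(V⟨x−e_μ,μ⟩⁻¹)·(D_μG)(x−e_μ)` for every field `G`. [cite: Balaban1985BackgroundPropagators, (3.8) p.392] -/
theorem covDstar_eq_neg_R_covD (G : Site P j → 𝔸) (μ : Fin P.d) (x : Site P j) :
    covDstar (torusT P j) (fun κ z => V ⟨z, κ⟩) μ G x
      = -R (V ⟨(torusT P j μ).symm x, μ⟩)⁻¹ (covD (torusT P j) (fun κ z => V ⟨z, κ⟩) μ G ((torusT P j μ).symm x)) := by
  simp only [covDstar, covD]
  rw [Equiv.apply_symm_apply, R_sub, R_inv_R]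
  abel

/-- ★★ **THE COVARIANT LAPLACIAN OF THE AXIAL LOCAL MODEL**: with no wrap-around at `⟨x,μ⟩` and `⟨x−e_μ,μ⟩` for every `μ`,
`Δ_VΨ(x) = R(v₀(x)⁻¹)·Σ_μ (2m − R(h(x−e_μ,μ)⁻¹)m − R(h(x,μ))m)`, `h(z,μ)` the loop of (27) at `⟨z,μ⟩` — adjacent PARALLEL thin loops of the same orientation.
[cite: Balaban1985UV3, (27) p.263; Balaban1985BackgroundPropagators, (3.3)-(3.4) pp.390-391, (3.8) p.392] -/
theorem lap_axialModel (x : Site P j) (hx : ∀ μ : Fin P.d, (rel c x μ + 1) * 2 ≤ (P.sitesPerDir j : ℤ))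
    (hx' : ∀ μ : Fin P.d, (rel c ((torusT P j μ).symm x) μ + 1) * 2 ≤ (P.sitesPerDir j : ℤ)) :
    divB (torusT P j) (fun κ z => V ⟨z, κ⟩) (fun μ => covD (torusT P j) (fun κ z => V ⟨z, κ⟩) μ (fun z => R (axialT V c z)⁻¹ m)) x
      = R (axialT V c x)⁻¹ (∑ μ : Fin P.d, (2 • m - R (holT V c (contourT c ⟨(torusT P j μ).symm x, μ⟩))⁻¹ m - R (holT V c (contourT c ⟨x, μ⟩)) m)) := by
  simp only [divB]
  rw [R_finset_sum]
  refine Finset.sum_congr rfl fun μ _ => ?_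
  simp only [covDstar]
  rw [covD_axialModel V c m μ x (hx μ), covD_axialModel V c m μ _ (hx' μ)]
  -- transport of the loop at `x − e_μ`: `V⟨x−e_μ,μ⟩⁻¹ · v₀(x−e_μ)⁻¹ = v₀(x)⁻¹ · h(x−e_μ,μ)⁻¹`
  have hloop := holT_contourT V c ⟨(torusT P j μ).symm x, μ⟩ (hx' μ)
  have htgt : PBond.tgt ⟨(torusT P j μ).symm x, μ⟩ = x := by
    show torusT P j μ ((torusT P j μ).symm x) = x
    exact Equiv.apply_symm_apply _ _
  rw [htgt] at hloop
  have hkey : (V ⟨(torusT P j μ).symm x, μ⟩)⁻¹ * (axialT V c ((torusT P j μ).symm x))⁻¹ = (axialT V c x)⁻¹ * (holT V c (contourT c ⟨(torusT P j μ).symm x, μ⟩))⁻¹ := by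
    rw [hloop]; group
  have e2 : R (V ⟨(torusT P j μ).symm x, μ⟩)⁻¹ (R (axialT V c ((torusT P j μ).symm x))⁻¹ (R (holT V c (contourT c ⟨(torusT P j μ).symm x, μ⟩)) m - m))
      = R (axialT V c x)⁻¹ (m - R (holT V c (contourT c ⟨(torusT P j μ).symm x, μ⟩))⁻¹ m) := by
    rw [← B9Eq39Adjoint.R_mul, hkey, B9Eq39Adjoint.R_mul, R_sub, R_inv_R]
  rw [e2, ← R_sub]
  congr 1
  rw [two_smul]
  abel

end Ring

/-! ## §2 The commutator-currency rows -/

section Normed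

variable {𝔸 : Type*} [NormedRing 𝔸] [NormOneClass 𝔸] {P : Params} {j : ℕ} (V : GaugeField P j 𝔸ˣ)
  (hV : ∀ b : PBond P j, ‖(V b : 𝔸)‖ ≤ 1 ∧ ‖(((V b)⁻¹ : 𝔸ˣ) : 𝔸)‖ ≤ 1) (c : Site P j) (m : 𝔸)

include hV

/-- transports along words are bi-contractive. [folklore] -/
theorem bicontr_holT : ∀ (x : Site P j) (w : List (B7Prop1Explicit.Letter P.d)),
    ‖((holT V x w : 𝔸ˣ) : 𝔸)‖ ≤ 1 ∧ ‖(((holT V x w)⁻¹ : 𝔸ˣ) : 𝔸)‖ ≤ 1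
  | x, [] => by simp [holT]
  | x, (μ, true) :: w => by
    obtain ⟨h1, h2⟩ := bicontr_holT (x.shift μ) w
    refine ⟨?_, ?_⟩
    · rw [B10Eq27TorusAxialLog.holT_cons_true, Units.val_mul]
      exact (norm_mul_le _ _).trans (by nlinarith [(hV ⟨x, μ⟩).1, norm_nonneg ((V ⟨x, μ⟩ : 𝔸ˣ) : 𝔸), norm_nonneg ((holT V (x.shift μ) w : 𝔸ˣ) : 𝔸)])
    · rw [B10Eq27TorusAxialLog.holT_cons_true, mul_inv_rev, Units.val_mul]
      exact (norm_mul_le _ _).trans (by nlinarith [(hV ⟨x, μ⟩).2, norm_nonneg (((V ⟨x, μ⟩)⁻¹ : 𝔸ˣ) : 𝔸), norm_nonneg (((holT V (x.shift μ) w)⁻¹ : 𝔸ˣ) : 𝔸)])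
  | x, (μ, false) :: w => by
    obtain ⟨h1, h2⟩ := bicontr_holT (x.unshift μ) w
    refine ⟨?_, ?_⟩
    · rw [B10Eq27TorusAxialLog.holT_cons_false, Units.val_mul]
      exact (norm_mul_le _ _).trans (by nlinarith [(hV ⟨x.unshift μ, μ⟩).2, norm_nonneg (((V ⟨x.unshift μ, μ⟩)⁻¹ : 𝔸ˣ) : 𝔸), norm_nonneg ((holT V (x.unshift μ) w : 𝔸ˣ) : 𝔸)])
    · rw [B10Eq27TorusAxialLog.holT_cons_false, mul_inv_rev, inv_inv, Units.val_mul]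
      exact (norm_mul_le _ _).trans (by nlinarith [(hV ⟨x.unshift μ, μ⟩).1, norm_nonneg ((V ⟨x.unshift μ, μ⟩ : 𝔸ˣ) : 𝔸), norm_nonneg (((holT V (x.unshift μ) w)⁻¹ : 𝔸ˣ) : 𝔸)])

/-- ★ **FIRST-ORDER ROW**: `‖D_VΨ(x,μ)‖ ≤ N_m(h(x,μ))`, `h(x,μ) = V(loop of (27) at ⟨x,μ⟩)` — zero when `m` commutes with the loop holonomy.
[cite: Balaban1985UV3, (27) p.263; Balaban1985BackgroundPropagators, (3.3) p.390] -/
theorem norm_covD_axialModel_le (μ : Fin P.d) (x : Site P j) (hx : (rel c x μ + 1) * 2 ≤ (P.sitesPerDir j : ℤ)) :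
    ‖covD (torusT P j) (fun κ z => V ⟨z, κ⟩) μ (fun z => R (axialT V c z)⁻¹ m) x‖
      ≤ ‖((holT V c (contourT c ⟨x, μ⟩) : 𝔸ˣ) : 𝔸) * m - m * ((holT V c (contourT c ⟨x, μ⟩) : 𝔸ˣ) : 𝔸)‖ := by
  rw [covD_axialModel V c m μ x hx]
  have hA := bicontr_holT V hV c (B7Prop1Explicit.treeWord (rel c x))
  have hAinv : ‖(((axialT V c x)⁻¹ : 𝔸ˣ) : 𝔸)‖ ≤ 1 ∧ ‖((((axialT V c x)⁻¹)⁻¹ : 𝔸ˣ) : 𝔸)‖ ≤ 1 := by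
    rw [inv_inv]; exact ⟨hA.2, hA.1⟩
  exact (norm_R_le hAinv _).trans (norm_R_sub_self_le_comm_of_inv (bicontr_holT V hV c _).2 m)

/-- **ADJOINT FIRST-ORDER ROW**: `‖D*_VΨ(x,μ)‖ ≤ N_m(h(x−e_μ,μ))`. [cite: Balaban1985BackgroundPropagators, (3.8) p.392] -/
theorem norm_covDstar_axialModel_le (μ : Fin P.d) (x : Site P j) (hx' : (rel c ((torusT P j μ).symm x) μ + 1) * 2 ≤ (P.sitesPerDir j : ℤ)) :
    ‖covDstar (torusT P j) (fun κ z => V ⟨z, κ⟩) μ (fun z => R (axialT V c z)⁻¹ m) x‖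
      ≤ ‖((holT V c (contourT c ⟨(torusT P j μ).symm x, μ⟩) : 𝔸ˣ) : 𝔸) * m - m * ((holT V c (contourT c ⟨(torusT P j μ).symm x, μ⟩) : 𝔸ˣ) : 𝔸)‖ := by
  rw [covDstar_eq_neg_R_covD, norm_neg]
  have hU := hV ⟨(torusT P j μ).symm x, μ⟩
  have hUinv : ‖(((V ⟨(torusT P j μ).symm x, μ⟩)⁻¹ : 𝔸ˣ) : 𝔸)‖ ≤ 1 ∧ ‖((((V ⟨(torusT P j μ).symm x, μ⟩)⁻¹)⁻¹ : 𝔸ˣ) : 𝔸)‖ ≤ 1 := by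
    rw [inv_inv]; exact ⟨hU.2, hU.1⟩
  exact (norm_R_le hUinv _).trans (norm_covD_axialModel_le V hV c m μ _ hx')

/-- ★★ **SECOND-ORDER ROW (the Laplacian group per site)**: `‖Δ_VΨ(x)‖ ≤ Σ_μ [N_m(h(x−e_μ,μ)⁻¹·h(x,μ)) + 2‖h(x−e_μ,μ) − 1‖·N_m(h(x−e_μ,μ))]` — the commutator of `m` with the
DOUBLE LADDER `h(x−e_μ,μ)⁻¹h(x,μ)` (two adjacent parallel thin loops: a product of transported curvature DIFFERENCES; on the last comb segment their `μ`-sum is the Yang–Mills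
current) plus a term quadratic in the loop defects. [cite: Balaban1985BackgroundPropagators, (3.3)-(3.4) pp.390-391; Balaban1985RegularSpaces, (1.1)-(1.2) p.76, (1.9) p.77] -/
theorem norm_lap_axialModel_le (x : Site P j) (hx : ∀ μ : Fin P.d, (rel c x μ + 1) * 2 ≤ (P.sitesPerDir j : ℤ))
    (hx' : ∀ μ : Fin P.d, (rel c ((torusT P j μ).symm x) μ + 1) * 2 ≤ (P.sitesPerDir j : ℤ)) :
    ‖divB (torusT P j) (fun κ z => V ⟨z, κ⟩) (fun μ => covD (torusT P j) (fun κ z => V ⟨z, κ⟩) μ (fun z => R (axialT V c z)⁻¹ m)) x‖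
      ≤ ∑ μ : Fin P.d,
          (‖(((holT V c (contourT c ⟨(torusT P j μ).symm x, μ⟩))⁻¹ * holT V c (contourT c ⟨x, μ⟩) : 𝔸ˣ) : 𝔸) * m
              - m * (((holT V c (contourT c ⟨(torusT P j μ).symm x, μ⟩))⁻¹ * holT V c (contourT c ⟨x, μ⟩) : 𝔸ˣ) : 𝔸)‖
            + 2 * ‖((holT V c (contourT c ⟨(torusT P j μ).symm x, μ⟩) : 𝔸ˣ) : 𝔸) - 1‖
              * ‖((holT V c (contourT c ⟨(torusT P j μ).symm x, μ⟩) : 𝔸ˣ) : 𝔸) * m - m * ((holT V c (contourT c ⟨(torusT P j μ).symm x, μ⟩) : 𝔸ˣ) : 𝔸)‖) := by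
  rw [lap_axialModel V c m x hx hx']
  have hA := bicontr_holT V hV c (B7Prop1Explicit.treeWord (rel c x))
  have hAinv : ‖(((axialT V c x)⁻¹ : 𝔸ˣ) : 𝔸)‖ ≤ 1 ∧ ‖((((axialT V c x)⁻¹)⁻¹ : 𝔸ˣ) : 𝔸)‖ ≤ 1 := by
    rw [inv_inv]; exact ⟨hA.2, hA.1⟩
  refine (norm_R_le hAinv _).trans ((norm_sum_le _ _).trans (Finset.sum_le_sum fun μ _ => ?_))
  set h₁ : 𝔸ˣ := holT V c (contourT c ⟨x, μ⟩) with hh₁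
  set h₂ : 𝔸ˣ := holT V c (contourT c ⟨(torusT P j μ).symm x, μ⟩) with hh₂
  have b₁ : ‖(h₁ : 𝔸)‖ ≤ 1 ∧ ‖((h₁⁻¹ : 𝔸ˣ) : 𝔸)‖ ≤ 1 := bicontr_holT V hV c _
  have b₂ : ‖(h₂ : 𝔸)‖ ≤ 1 ∧ ‖((h₂⁻¹ : 𝔸ˣ) : 𝔸)‖ ≤ 1 := bicontr_holT V hV c _
  have b₂inv : ‖((h₂⁻¹ : 𝔸ˣ) : 𝔸)‖ ≤ 1 ∧ ‖(((h₂⁻¹)⁻¹ : 𝔸ˣ) : 𝔸)‖ ≤ 1 := by rw [inv_inv]; exact ⟨b₂.2, b₂.1⟩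
  -- `2m − R(h₂⁻¹)m − R(h₁)m = −[(R(h₁)m − R(h₂)m) + (R(h₂⁻¹) − 1)(R(h₂)m − m)]`, and `R(h₁)m − R(h₂)m = R(h₂)(R(h₂⁻¹h₁)m − m)`
  have e : (2 : ℕ) • m - R h₂⁻¹ m - R h₁ m = -((R h₂ (R (h₂⁻¹ * h₁) m - m)) + ((R h₂ m - m) - R h₂⁻¹ (R h₂ m - m))) := by
    rw [← R_sub_R_eq h₁ h₂ m, R_sub, R_inv_R, two_smul]
    abel
  rw [e, norm_neg]
  refine (norm_add_le _ _).trans (add_le_add ?_ ?_)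
  · exact (norm_R_le b₂ _).trans (norm_R_sub_self_le_comm_of_inv (by
      rw [mul_inv_rev, inv_inv, Units.val_mul]; exact (norm_mul_le _ _).trans (by nlinarith [b₂.1, b₁.2, norm_nonneg ((h₁⁻¹ : 𝔸ˣ) : 𝔸), norm_nonneg (h₂ : 𝔸)])) m)
  · -- `‖R(h₂⁻¹)X − X‖ ≤ N_X(h₂) ≤ 2‖h₂ − 1‖·‖X‖`, `X = R(h₂)m − m`, `‖X‖ ≤ N_m(h₂)`
    have hX : ‖R h₂ m - m‖ ≤ ‖(h₂ : 𝔸) * m - m * (h₂ : 𝔸)‖ := norm_R_sub_self_le_comm_of_inv b₂.2 m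
    have h1 := norm_R_inv_sub_self_le_comm_of_inv b₂.2 (R h₂ m - m)
    rw [norm_sub_rev]
    refine h1.trans ?_
    rw [comm_sub_one]
    refine (norm_sub_le _ _).trans ?_
    have n1 := norm_mul_le ((h₂ : 𝔸) - 1) (R h₂ m - m)
    have n2 := norm_mul_le (R h₂ m - m) ((h₂ : 𝔸) - 1)
    nlinarith [hX, norm_nonneg ((h₂ : 𝔸) - 1), norm_nonneg (R h₂ m - m)]

end Normed

end Summit.QuantumFields.YangMills.Theorems.Prop7AxialLocalModel

end
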